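import Literature.NumberTheory.EllipticCurves.GoldfeldProportionsCremona19a3
import Literature.NumberTheory.EllipticCurves.SelmerCardinalityPConverses
import Literature.NumberTheory.EllipticCurves.BSDSelmerCMPConverseCMFieldTwistFamilyPrintedProofs
import HarnessLib

/-!
# The `3`-parity bridge for the `19a3` proportions: `#Sel₃(E_d) = 3 ∧ E_d(ℚ)[3] = 0 ⟹
# corank_{ℤ₃} Sel_{3^∞}(E_d) = 1`, and the passage BKLOS §2 ⟹ Keller–Yin Cor. 3.8.1 it carries —
# THEOREMS ONLY (no definition, no named fact, no claim)

Cross-ladder LITERATURE-TYPING layer (D-0088(4)), cell `bsd-littype`, seat `bsd-littype-06` (gen 4),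
OPEN-QUESTIONS-06 Q-B6. The gen-2 file `GoldfeldProportionsCremona19a3.lean` records (module
docstring) that the printed proof of Keller–Yin arXiv:2410.23241v1 Cor. 3.8.1 — "at least `5/12` of
the quadratic twists of `19a3` have algebraic and analytic rank `1`" — passes from BKLOS's currency
"`3`-Selmer rank `1`" (`#Sel^{(3)}(E_d/ℚ) = 3`) to the `3^∞`-Selmer CORANK `1` needed by the
`p`-converse theorems through a Cassels–Tate parity step "the printed proof leaves implicit", and
that this bridge and the monotonicity of `SquareClassProportionGe` were "neither in the tree". Both
ARE in the tree now: the bridge is `selmerCorank_eq_one_of_natCard_selmerGroup_eq`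
(`SelmerCardinalityPConverses.lean`: `#Sel^{(p)}(E/K) = p ∧ #E(K)[p] = 1 ⟹ corank_{ℤ_p} Sel_{p^∞}(E/K) = 1`,
modulo the REFEREED named fact `WeierstrassCurve.exists_casselsTate_pairing`, Silverman X.4.14 /
Cassels 1962 — Dokchitser, *Notes on the parity conjecture*, §2, `rk_p = rk + δ_p`), the monotonicity
is `SquareClassProportionGe.mono` (`BSDSelmerCMPConverseCMFieldTwistFamilyPrintedProofs.lean`). This
file composes them for the twist family of `19a3`:

* `selmerCorank_three_quadraticTwist_eq_one` — pointwise: `#Sel₃(E_d) = 3`, `#E_d(ℚ)[3] = 1` ⟹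
  `corank_{ℤ₃} Sel_{3^∞}(E_d/ℚ) = 1` (`E_d = cremona19a3.quadraticTwist d`, `d ≠ 0`; CONDITIONAL on
  `exists_casselsTate_pairing` over `ℚ`);
* `twistClassSatisfies_selmerCorank_three_eq_one` — the same along a square class;
* `twistClassSatisfies_rank_one_of_cor381_OPEN'`, `squareClassProportionGe_rank_one_of_cor381_OPEN` —
  with clause (A) of the Keller–Yin claim `cor381_cremona19a3_twists_OPEN` (corank `1` ⟹ algebraic and
  analytic rank `1`): every class / at least the same proportion `δ` of classes with
  "`#Sel₃ = 3 ∧ E_d(ℚ)[3] = 0`" has algebraic and analytic rank `1`.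

What remains between BKLOS's typed clause (b) (`≥ 5/12` of classes with `#Sel₃(E_d) = 3`, no torsion
condition) and the `5/12` clause of Cor. 3.8.1 is now ONLY: "`E_d(ℚ)[3] = 0` off finitely many square
classes" (for `19a3`: `E[3] ≅ ℤ/3 ⊕ μ₃` as a Galois module, so `E_d(ℚ)[3] ≠ 0` iff `d ∈ {1, −3}·ℚ^{×2}`)
together with the insensitivity of `SquareClassProportionGe` (a `liminf`) to finitely many classes —
recorded on HOME/OPEN-QUESTIONS-06 §E, not proved here.

## References

* [BhargavaKlagsbrunLemkeOliverShnidman2019] §2, paragraph after Thm. 2.6 (the `19a3` proportions).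
* Keller–Yin, arXiv:2410.23241v1, Cor. 3.8.1 (p0021 L53–L62) — UNREFEREED claim, used only as a
  hypothesis (`cor381_cremona19a3_twists_OPEN`).
* [Dokchitser2013ParityNotes] §2 (`rk_p = rk + δ_p`); [SilvermanAEC2009] Thm. X.4.14 (Cassels–Tate).
-/

set_option autoImplicit false

noncomputable section

open scoped Classical AddSubgroup

open WeierstrassCurve

namespace Literature.NumberTheory.EllipticCurves

/-! ### §1 The bridge, pointwise and along square classes -/

/-- **`#Sel₃(E_d/ℚ) = 3` and `#E_d(ℚ)[3] = 1` ⟹ `corank_{ℤ₃} Sel_{3^∞}(E_d/ℚ) = 1`** for the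
quadratic twists `E_d = 19a3^{(d)}`, `d ≠ 0` (elliptic: `Δ(E_d) = d⁶ Δ ≠ 0`) — the tree theorem
`selmerCorank_eq_one_of_natCard_selmerGroup_eq` (Dokchitser 2013 §2: `rk_p = rk + δ_p`, the finite
part of `Ш[p^∞]` has square order), CONDITIONAL on the Cassels–Tate pairing over `ℚ`.
[cite: Dokchitser2013ParityNotes, §2 (`rk_p = rk + δ_p`)] [cite: SilvermanAEC2009, Thm. X.4.14] -/
theorem selmerCorank_three_quadraticTwist_eq_one (hCT : exists_casselsTate_pairing (K := ℚ))
    {d : ℚ} (hd : d ≠ 0) (h3 : Nat.card ((cremona19a3.quadraticTwist d).selmerGroup 3) = 3)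
    (ht : Nat.card ((cremona19a3.quadraticTwist d).toAffine.Point[(3 : ℤ)]) = 1) :
    (cremona19a3.quadraticTwist d).selmerCorank 3 = 1 := by
  haveI := cremona19a3_isElliptic
  haveI := cremona19a3.isElliptic_quadraticTwist hd
  haveI : Fact (Nat.Prime 3) := ⟨Nat.prime_three⟩
  -- (the `DecidableEq ℚ` instance inside `Affine.Point`'s group structure: concrete vs classical)
  refine selmerCorank_eq_one_of_natCard_selmerGroup_eq hCT _ 3 h3 ?_
  convert ht using 4 with x
  simp only [AddSubgroup.torsionBy, Submodule.mem_toAddSubgroup, Submodule.mem_torsionBy_iff,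
    Nat.cast_ofNat]
  have hdec : (instDecidableEqRat : DecidableEq ℚ) = fun a b ↦ Classical.propDecidable (a = b) :=
    Subsingleton.elim _ _
  rw [hdec]

/-- **The bridge along a square class**: a class of twists with `#Sel₃ = 3` and no rational
`3`-torsion is a class of `3^∞`-Selmer-corank-`1` twists (representatives `s ∈ ℚ^×` are nonzero;
`TwistClassSatisfies.mono` pattern). CONDITIONAL on the Cassels–Tate pairing over `ℚ`.
[cite: Dokchitser2013ParityNotes, §2 (`rk_p = rk + δ_p`)] -/
theorem twistClassSatisfies_selmerCorank_three_eq_one (hCT : exists_casselsTate_pairing (K := ℚ))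
    {t : SquareClass ℚ}
    (h : TwistClassSatisfies cremona19a3
      (fun E : WeierstrassCurve ℚ ↦
        Nat.card (E.selmerGroup 3) = 3 ∧ Nat.card (E.toAffine.Point[(3 : ℤ)]) = 1) t) :
    TwistClassSatisfies cremona19a3 (fun E : WeierstrassCurve ℚ ↦ E.selmerCorank 3 = 1) t :=
  fun s hs ↦ selmerCorank_three_quadraticTwist_eq_one hCT (Units.ne_zero s) (h s hs).1 (h s hs).2

/-! ### §2 With Keller–Yin Cor. 3.8.1 (A): BKLOS currency ⟹ rank one -/

namespace KellerYin2024

/-- **BKLOS currency ⟹ algebraic and analytic rank `1`, along a square class**: granted clause (A)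
of the Keller–Yin claim (`cor381_cremona19a3_twists_OPEN`: corank `1` ⟹ ranks `1`) and the
Cassels–Tate pairing over `ℚ`, every class of twists of `19a3` with `#Sel₃ = 3` and `E_d(ℚ)[3] = 0`
is a class of twists of algebraic AND analytic rank `1` — the printed passage "BKLOS ⟹ Cor. 3.8.1"
at one class. CONDITIONAL on the claim and the fact; nothing asserted.
[claim: KellerYin2024PotOrd, status: under-review] -/
theorem twistClassSatisfies_rank_one_of_cor381_OPEN' (h381 : cor381_cremona19a3_twists_OPEN)
    (hCT : exists_casselsTate_pairing (K := ℚ)) {t : SquareClass ℚ}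
    (h : TwistClassSatisfies cremona19a3
      (fun E : WeierstrassCurve ℚ ↦
        Nat.card (E.selmerGroup 3) = 3 ∧ Nat.card (E.toAffine.Point[(3 : ℤ)]) = 1) t) :
    TwistClassSatisfies cremona19a3
      (fun E : WeierstrassCurve ℚ ↦ E.mordellWeilRank = 1 ∧ E.analyticRank = 1) t :=
  twistClassSatisfies_rank_one_of_cor381_OPEN h381
    (twistClassSatisfies_selmerCorank_three_eq_one hCT h)

/-- **BKLOS currency ⟹ rank one, in proportion**: if at least `δ` of the square classes `t` (BKLOS
height ordering, `SquareClassProportionGe`) consist of twists of `19a3` with `#Sel₃ = 3` and no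
rational `3`-torsion, then — granted clause (A) of Cor. 3.8.1 and the Cassels–Tate pairing — at least
`δ` of them consist of twists of algebraic and analytic rank `1` (`SquareClassProportionGe.mono`).
With `δ = 5/12` this is the `5/12` clause of Cor. 3.8.1 MODULO the torsion condition, which BKLOS's
typed clause (b) (`proportion_card_selmerGroup_three_eq_three_ge`) does not carry: `E_d(ℚ)[3] ≠ 0`
only on the classes of `1` and `−3` (not proved here). CONDITIONAL on the claim and the fact.
[claim: KellerYin2024PotOrd, status: under-review] -/
theorem squareClassProportionGe_rank_one_of_cor381_OPEN (h381 : cor381_cremona19a3_twists_OPEN)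
    (hCT : exists_casselsTate_pairing (K := ℚ)) {δ : ℝ}
    (h : SquareClassProportionGe
      (TwistClassSatisfies cremona19a3 fun E : WeierstrassCurve ℚ ↦
        Nat.card (E.selmerGroup 3) = 3 ∧ Nat.card (E.toAffine.Point[(3 : ℤ)]) = 1) δ) :
    SquareClassProportionGe
      (TwistClassSatisfies cremona19a3 fun E : WeierstrassCurve ℚ ↦
        E.mordellWeilRank = 1 ∧ E.analyticRank = 1) δ :=
  h.mono fun _ ht ↦ twistClassSatisfies_rank_one_of_cor381_OPEN' h381 hCT ht

end KellerYin2024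

end Literature.NumberTheory.EllipticCurves

end
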